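import Mathlib.Analysis.InnerProductSpace.PiL2
import Mathlib.Analysis.InnerProductSpace.Calculus
import Mathlib.Analysis.Calculus.ContDiff.Basic
import Mathlib.Analysis.Calculus.ContDiff.Deriv
import Mathlib.Analysis.Calculus.Deriv.Shift
import Mathlib.LinearAlgebra.CrossProduct
import Mathlib.LinearAlgebra.Matrix.DotProduct
import Mathlib.MeasureTheory.Function.Jacobian
import Mathlib.MeasureTheory.Measure.Lebesgue.EqHaar
import Mathlib.Geometry.Manifold.Instances.Sphere
import Mathlib.Geometry.Manifold.SmoothEmbedding
import Mathlib.Geometry.Manifold.MFDeriv.Atlas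
import Mathlib.Geometry.Manifold.ContMDiffMFDeriv
import Literature.Topology.FourManifolds.TorusCoordinates
import Literature.Topology.FourManifolds.Knots
import HarnessLib

/-!
# Smooth knots are framed regular closed curves

Groundwork for the tubular neighbourhood of a smooth knot `K : S¹ → S³` (`Literature.Topology.FourManifolds.Knot`, a `C^∞`
embedding in the sense of `Manifold.IsSmoothEmbedding`), used by `KnotTube.lean` /
`KnotTubeProofs.lean` to build a topological tube `S¹ × ℝ² ↪ S³` around every knot and thereby
discharge the named facts `Literature.Topology.FourManifolds.Knot.fg_group` (knot groups are finitely generated) and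
`Literature.Topology.FourManifolds.Knot.IsAlexanderPolynomial.isUnit_eval_one` (`Δ_K(1) = ±1`). Everything here is proved.

## Contents

* `Literature.Topology.FourManifolds.circlePt_eq_circlePt_iff`, `Literature.Topology.FourManifolds.exists_local_section_circlePt`,
  `Literature.Topology.FourManifolds.mfderiv_circlePt_injective`: the covering `circlePt : ℝ → S¹`, `t ↦ (cos 2πt, sin 2πt)`
  (`TorusCoordinates.lean`) identifies points exactly modulo `ℤ`, has the local smooth sections
  `angA`, `angB` (up to integer shifts), and has injective differential.
* `Literature.Topology.FourManifolds.Manifold.IsImmersionAtOfComplement.mfderiv_injective`: a `C^n` immersion (`n ≠ 0`) in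
  Mathlib's chart sense has injective differential `mfderiv` (the easy direction of the TODO in
  `Mathlib.Geometry.Manifold.Immersion`; general manifolds).
* `Literature.Knot.curve K : ℝ → ℝ⁴`, `t ↦ K (circlePt t)`: the unit-period parametrisation of a knot; it
  is `C^∞`, `1`-periodic, takes values on the unit sphere, identifies parameters exactly modulo `ℤ`
  (`Literature.Topology.FourManifolds.Knot.curve_eq_curve_iff`), and is **regular**: `Literature.Topology.FourManifolds.Knot.deriv_curve_ne_zero`
  (three injective differentials: covering, immersion, inclusion `S³ ⊆ ℝ⁴`).
* `Literature.Topology.FourManifolds.quatI`, `Literature.Topology.FourManifolds.quatJ`, `Literature.Topology.FourManifolds.quatK`, `Literature.Topology.FourManifolds.quatFrame`: right multiplication by `i`, `j`, `k` on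
  `ℝ⁴ = ℍ`, the classical orthonormal parallelisation of `T S³` (`Literature.Topology.FourManifolds.quatFrame_complete`);
  `Literature.Topology.FourManifolds.frameLift`, `Literature.Topology.FourManifolds.frameCoord`: passage between coefficient vectors in `ℝ³` and tangent
  vectors in `p^⊥`.
* `Literature.Topology.FourManifolds.exists_forall_smul_ne`: a differentiable one-parameter family of lines through `0` does not
  cover `ℝ³` (the union is the image of a plane under a differentiable map, hence Lebesgue-null —
  the trivial case of Sard's theorem, via
  `MeasureTheory.addHaar_image_eq_zero_of_differentiableOn_of_addHaar_eq_zero`).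
* `Literature.Topology.FourManifolds.exists_normal_framing`: **every `C^∞` regular closed curve on `S³ ⊆ ℝ⁴` has a `C^∞` normal
  framing** `n₁, n₂` (periodic, with `k, k', n₁, n₂` pairwise orthogonal and nonzero): in the
  quaternion trivialisation the unit tangent is a smooth loop `a` in `ℝ³ ∖ 0`; pick an axis `p` off
  all the lines `ℝ · a(t)`, project it orthogonally to `a` and take the cross product. In other
  words, the normal bundle of a knot in `S³` is trivial, with an explicit trivialisation.

## Design

We compute in the coordinates of `EuclideanSpace ℝ (Fin 4)`, where `Literature.Topology.FourManifolds.Knot` takes its values,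
rather than through Mathlib's `Quaternion ℝ` or the bundle-level notion `Literature.Topology.FourManifolds.IsParallelizable`
(`Spin.lean`): all that is needed are the three explicit, pairwise orthogonal, linear vector
fields `p ↦ p·i, p·j, p·k` and their multiplication table (`quatFrame_complete`), a dozen `simp`
lemmas proved by `ring`.

## Sources

Standard differential topology; all statements are tagged `[folklore]` (tubular neighbourhoods:
M. W. Hirsch, *Differential Topology* (1976), §4.5; the setting of differentiable knots:
R. H. Crowell, R. H. Fox, *Introduction to Knot Theory* (GTM 57), Ch. I §2). No named facts are
introduced.
-/

open scoped Manifold ContDiff Topology Real RealInnerProductSpace Matrix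
open Set Function Metric

noncomputable section

universe u

namespace Literature.Topology.FourManifolds


/-- Local notation: `𝔼 n` is the model Euclidean space `EuclideanSpace ℝ (Fin n)`. -/
local notation "𝔼 " n:arg => EuclideanSpace ℝ (Fin n)

/-- Local notation: `𝕊 n` is the unit sphere in `EuclideanSpace ℝ (Fin (n + 1))`. -/
local notation "𝕊 " n:arg => (Metric.sphere (0 : EuclideanSpace ℝ (Fin (n + 1))) 1)

/-! ### The covering `circlePt : ℝ → 𝕊¹`: periodicity and local smooth sections -/

section CirclePt

/-- `circlePt` has period `1`. [folklore] -/
theorem periodic_circlePt : Periodic circlePt 1 := circlePt_add_one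

/-- `circlePt (t + m) = circlePt t` for an integer `m`. [folklore] -/
theorem circlePt_add_int (t : ℝ) (m : ℤ) : circlePt (t + m) = circlePt t := by
  have := (periodic_circlePt.int_mul m) t
  rwa [mul_one] at this

/-- `circlePt s = circlePt t` iff `s - t ∈ ℤ`. [folklore] -/
theorem circlePt_eq_circlePt_iff {s t : ℝ} : circlePt s = circlePt t ↔ ∃ m : ℤ, s = t + m := by
  constructor
  · intro h
    have h' : Circle.exp (2 * π * s) = Circle.exp (2 * π * t) := by
      rw [← toCircle_circlePt, ← toCircle_circlePt, h]
    obtain ⟨m, hm⟩ := Circle.exp_eq_exp.1 h'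
    refine ⟨m, ?_⟩
    have hπ : (2 * π : ℝ) ≠ 0 := by positivity
    have : 2 * π * s = 2 * π * (t + m) := by rw [hm]; ring
    exact mul_left_cancel₀ hπ this
  · rintro ⟨m, rfl⟩
    exact circlePt_add_int t m

/-- **Local smooth sections of `circlePt`.** Every `t₀ : ℝ` admits a function `ang : 𝕊¹ → ℝ`,
smooth at `circlePt t₀`, with `ang (circlePt t) = t` for all `t` near `t₀` (one of the two angle
functions `angA`, `angB` shifted by an integer). [folklore] -/
theorem exists_local_section_circlePt (t₀ : ℝ) :
    ∃ ang : 𝕊 1 → ℝ, ContMDiffAt (𝓡 1) 𝓘(ℝ, ℝ) ∞ ang (circlePt t₀) ∧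
      ∀ᶠ t in 𝓝 t₀, ang (circlePt t) = t := by
  by_cases hA : circlePt t₀ = ptA
  · -- use `angB`, valid on `(1/2, 3/2)`
    have hB : circlePt t₀ ≠ ptB := fun h => ptA_ne_ptB (hA.symm.trans h)
    have hs := angB_mem_Ioo hB
    obtain ⟨m, hm⟩ := circlePt_eq_circlePt_iff.1 (circlePt_angB (circlePt t₀)).symm
    -- `t₀ = angB (circlePt t₀) + m`
    refine ⟨fun z => angB z + m, (contMDiffAt_angB hB).add contMDiffAt_const, ?_⟩
    have hopen : IsOpen ((fun t : ℝ => t - m) ⁻¹' Ioo (1 / 2 : ℝ) (3 / 2)) :=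
      isOpen_Ioo.preimage (by fun_prop)
    have hmem : t₀ ∈ (fun t : ℝ => t - m) ⁻¹' Ioo (1 / 2 : ℝ) (3 / 2) := by
      show t₀ - m ∈ Ioo (1 / 2 : ℝ) (3 / 2)
      convert hs using 1
      linarith
    filter_upwards [hopen.mem_nhds hmem] with t ht
    have h1 : circlePt t = circlePt (t - m) := by
      rw [circlePt_eq_circlePt_iff]; exact ⟨m, by ring⟩
    rw [h1, angB_circlePt ht]
    ring
  · have hs := angA_mem_Ioo hA
    obtain ⟨m, hm⟩ := circlePt_eq_circlePt_iff.1 (circlePt_angA (circlePt t₀)).symm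
    refine ⟨fun z => angA z + m, (contMDiffAt_angA hA).add contMDiffAt_const, ?_⟩
    have hopen : IsOpen ((fun t : ℝ => t - m) ⁻¹' Ioo (0 : ℝ) 1) :=
      isOpen_Ioo.preimage (by fun_prop)
    have hmem : t₀ ∈ (fun t : ℝ => t - m) ⁻¹' Ioo (0 : ℝ) 1 := by
      show t₀ - m ∈ Ioo (0 : ℝ) 1
      convert hs using 1
      linarith
    filter_upwards [hopen.mem_nhds hmem] with t ht
    have h1 : circlePt t = circlePt (t - m) := by
      rw [circlePt_eq_circlePt_iff]; exact ⟨m, by ring⟩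
    rw [h1, angA_circlePt ht]
    ring

/-- The differential of `circlePt : ℝ → 𝕊¹` is injective at every point (it has the local
smooth left inverse of `exists_local_section_circlePt`). [folklore] -/
theorem mfderiv_circlePt_injective (t₀ : ℝ) :
    Injective (mfderiv 𝓘(ℝ, ℝ) (𝓡 1) circlePt t₀) := by
  obtain ⟨ang, hang, heq⟩ := exists_local_section_circlePt t₀
  have hc : MDifferentiableAt 𝓘(ℝ, ℝ) (𝓡 1) circlePt t₀ :=
    contMDiff_circlePt.contMDiffAt.mdifferentiableAt (by simp)
  have ha : MDifferentiableAt (𝓡 1) 𝓘(ℝ, ℝ) ang (circlePt t₀) := hang.mdifferentiableAt (by simp)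
  have h1 : mfderiv 𝓘(ℝ, ℝ) 𝓘(ℝ, ℝ) (ang ∘ circlePt) t₀ =
      (mfderiv (𝓡 1) 𝓘(ℝ, ℝ) ang (circlePt t₀)).comp (mfderiv 𝓘(ℝ, ℝ) (𝓡 1) circlePt t₀) :=
    mfderiv_comp t₀ ha hc
  have h2 : mfderiv 𝓘(ℝ, ℝ) 𝓘(ℝ, ℝ) (ang ∘ circlePt) t₀ = mfderiv 𝓘(ℝ, ℝ) 𝓘(ℝ, ℝ) id t₀ :=
    Filter.EventuallyEq.mfderiv_eq (heq.mono fun t ht => ht)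
  rw [mfderiv_id] at h2
  intro v w hvw
  have := congrArg (mfderiv (𝓡 1) 𝓘(ℝ, ℝ) ang (circlePt t₀)) hvw
  rw [← ContinuousLinearMap.comp_apply, ← ContinuousLinearMap.comp_apply, ← h1, h2] at this
  exact this

end CirclePt

/-! ### Immersions have injective differential -/

section Immersion

variable {E : Type*} [NormedAddCommGroup E] [NormedSpace ℝ E] {H : Type*} [TopologicalSpace H]
  {I : ModelWithCorners ℝ E H} {M : Type*} [TopologicalSpace M] [ChartedSpace H M]
  {E' : Type*} [NormedAddCommGroup E'] [NormedSpace ℝ E'] {H' : Type*} [TopologicalSpace H']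
  {J : ModelWithCorners ℝ E' H'} {N : Type*} [TopologicalSpace N] [ChartedSpace H' N]
  {F : Type*} [NormedAddCommGroup F] [NormedSpace ℝ F] {n : WithTop ℕ∞}

/-- **An immersion has injective differential.** If `f : M → N` is a `C^n` immersion at `x`
(`n ≠ 0`) in Mathlib's chart sense (`Manifold.IsImmersionAtOfComplement`: in maximal-atlas charts
`φ`, `ψ` around `x`, `f x` it reads `u ↦ L (u, 0)`), then `mfderiv I J f x` is injective:
differentiating `J ∘ ψ ∘ f = L ∘ (·, 0) ∘ I ∘ φ` at `x`, the right-hand side has injective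
differential (`φ` is a diffeomorphism onto its image), hence so has `f`. This is the easy
direction of the TODO "if `f` is an immersion at `x`, its differential splits, hence is injective"
of `Mathlib.Geometry.Manifold.Immersion`. [folklore] -/
theorem Manifold.IsImmersionAtOfComplement.mfderiv_injective [IsManifold I n M]
    [IsManifold J n N] {f : M → N} {x : M} (h : Manifold.IsImmersionAtOfComplement F I J n f x)
    (hn : n ≠ 0) : Injective (mfderiv I J f x) := by
  have hn1 : (1 : WithTop ℕ∞) ≤ n := ENat.one_le_iff_ne_zero_withTop.mpr hn
  haveI : IsManifold I 1 M := IsManifold.of_le (n := n) hn1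
  haveI : IsManifold J 1 N := IsManifold.of_le (n := n) hn1
  set φ := h.domChart with hφdef
  set ψ := h.codChart with hψdef
  have hxφ : x ∈ φ.source := h.mem_domChart_source
  have hfxψ : f x ∈ ψ.source := h.mem_codChart_source
  -- differentiability of the players
  have hf : MDifferentiableAt I J f x := h.contMDiffAt.mdifferentiableAt hn
  have hφM : φ.MDifferentiable I I :=
    ⟨(contMDiffOn_of_mem_maximalAtlas h.domChart_mem_maximalAtlas).mdifferentiableOn hn,
      (contMDiffOn_symm_of_mem_maximalAtlas h.domChart_mem_maximalAtlas).mdifferentiableOn hn⟩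
  have hψM : ψ.MDifferentiable J J :=
    ⟨(contMDiffOn_of_mem_maximalAtlas h.codChart_mem_maximalAtlas).mdifferentiableOn hn,
      (contMDiffOn_symm_of_mem_maximalAtlas h.codChart_mem_maximalAtlas).mdifferentiableOn hn⟩
  have hφd : MDifferentiableAt I I φ x := hφM.mdifferentiableAt hxφ
  have hψd : MDifferentiableAt J J ψ (f x) := hψM.mdifferentiableAt hfxψ
  -- the linear model `u ↦ L (u, 0)`
  set g : E →L[ℝ] E' := (h.equiv : E × F →L[ℝ] E').comp (ContinuousLinearMap.inl ℝ E F)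
    with hgdef
  have hg_inj : Injective g := h.equiv.injective.comp (Prod.mk_left_injective 0)
  -- the local formula `J ∘ ψ ∘ f = g ∘ I ∘ φ` near `x`
  have key : (J ∘ ψ ∘ f) =ᶠ[𝓝 x] (g ∘ I ∘ φ) := by
    filter_upwards [φ.open_source.mem_nhds hxφ] with y hy
    have hy' : y ∈ (φ.extend I).source := by rwa [OpenPartialHomeomorph.extend_source]
    have := h.writtenInCharts ((φ.extend I).map_source hy')
    rw [Function.comp_apply, Function.comp_apply, (φ.extend I).left_inv hy'] at this
    show J (ψ (f y)) = g (I (φ y))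
    simpa only [OpenPartialHomeomorph.extend_coe, Function.comp_apply, hgdef, hψdef,
      ContinuousLinearMap.coe_comp, ContinuousLinearEquiv.coe_coe,
      ContinuousLinearMap.inl_apply] using this
  -- differentiate both sides
  have hIφ : MDifferentiableAt I 𝓘(ℝ, E) (I ∘ φ) x := I.mdifferentiableAt.comp x hφd
  have hR : mfderiv I 𝓘(ℝ, E') (g ∘ I ∘ φ) x =
      (g : E →L[ℝ] E').comp ((ContinuousLinearMap.id ℝ E).comp (mfderiv I I φ x)) := by
    rw [show (g ∘ I ∘ φ) = (g ∘ (I ∘ φ)) from rfl,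
      mfderiv_comp x g.hasMFDerivAt.mdifferentiableAt hIφ,
      g.mfderiv_eq, mfderiv_comp x I.mdifferentiableAt hφd, I.hasMFDerivAt.mfderiv]
    rfl
  have hL : mfderiv I 𝓘(ℝ, E') (J ∘ ψ ∘ f) x =
      ((ContinuousLinearMap.id ℝ E').comp (mfderiv J J ψ (f x))).comp (mfderiv I J f x) := by
    rw [show (J ∘ ψ ∘ f) = ((J ∘ ψ) ∘ f) from rfl,
      mfderiv_comp x (J.mdifferentiableAt.comp (f x) hψd) hf,
      mfderiv_comp (f x) J.mdifferentiableAt hψd, J.hasMFDerivAt.mfderiv]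
    rfl
  have hinjR : Injective ((g : E →L[ℝ] E').comp ((ContinuousLinearMap.id ℝ E).comp
      (mfderiv I I φ x))) := by
    rw [ContinuousLinearMap.coe_comp, ContinuousLinearMap.coe_comp]
    exact hg_inj.comp (injective_id.comp (hφM.mfderiv_injective hxφ))
  rw [← hR, ← key.mfderiv_eq, hL, ContinuousLinearMap.coe_comp] at hinjR
  exact hinjR.of_comp

/-- **An immersion has injective differential** (`Manifold.IsImmersionAt` form). [folklore] -/
theorem Manifold.IsImmersionAt.mfderiv_injective {E' : Type u} [NormedAddCommGroup E']
    [NormedSpace ℝ E'] {H' : Type*} [TopologicalSpace H'] {J : ModelWithCorners ℝ E' H'}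
    {N : Type*} [TopologicalSpace N] [ChartedSpace H' N] [IsManifold I n M] [IsManifold J n N]
    {f : M → N} {x : M} (h : Manifold.IsImmersionAt I J n f x) (hn : n ≠ 0) :
    Injective (mfderiv I J f x) :=
  Manifold.IsImmersionAtOfComplement.mfderiv_injective h.isImmersionAtOfComplement_complement hn

end Immersion

/-! ### The regular closed curve of a knot -/

section KnotCurve

variable (K : Knot)

/-- The **unit-period parametrisation** `t ↦ K (cos 2πt, sin 2πt) ∈ ℝ⁴` of a knot
`K : 𝕊¹ → 𝕊³ ⊆ ℝ⁴`. [folklore] -/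
def Knot.curve (t : ℝ) : 𝔼 4 := (K (circlePt t) : 𝔼 4)

/-- `K.curve t = K (circlePt t)` (by definition). [folklore] -/
theorem Knot.curve_apply (t : ℝ) : K.curve t = (K (circlePt t) : 𝔼 4) := rfl

/-- The curve of a knot has period `1`. [folklore] -/
theorem Knot.periodic_curve : Periodic K.curve 1 := fun t => by
  simp only [Knot.curve, circlePt_add_one]

/-- The curve of a knot lies on the unit sphere. [folklore] -/
@[simp]
theorem Knot.norm_curve (t : ℝ) : ‖K.curve t‖ = 1 := norm_eq_of_mem_sphere _

/-- The curve of a knot is `C^∞` (as a map into the manifold `ℝ⁴`). [folklore] -/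
theorem Knot.contMDiff_curve : ContMDiff 𝓘(ℝ, ℝ) 𝓘(ℝ, 𝔼 4) ∞ K.curve :=
  haveI := Fact.mk (@finrank_euclideanSpace_fin ℝ _ (3 + 1))
  contMDiff_coe_sphere.comp (K.contMDiff.comp contMDiff_circlePt)

/-- The curve of a knot is `C^∞`. [folklore] -/
theorem Knot.contDiff_curve : ContDiff ℝ ∞ K.curve :=
  contMDiff_iff_contDiff.1 K.contMDiff_curve

/-- The curve of a knot is continuous. [folklore] -/
@[continuity, fun_prop]
theorem Knot.continuous_curve : Continuous K.curve := K.contDiff_curve.continuous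

/-- **A smooth knot is a regular curve**: the velocity `(K ∘ circlePt)' (t)` never vanishes.
The differential of `K.curve = (↑) ∘ K ∘ circlePt` is the composition of three injective
differentials: of the covering `circlePt` (`mfderiv_circlePt_injective`), of the immersion `K`
(`Manifold.IsImmersionAtOfComplement.mfderiv_injective`) and of the inclusion `𝕊³ ⊆ ℝ⁴`
(`mfderiv_coe_sphere_injective`). [folklore] -/
theorem Knot.deriv_curve_ne_zero (t : ℝ) : deriv K.curve t ≠ 0 := by
  haveI := Fact.mk (@finrank_euclideanSpace_fin ℝ _ (3 + 1))
  have h1 := mfderiv_circlePt_injective t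
  obtain ⟨F, _, _, hF⟩ := K.isSmoothEmbedding.isImmersion
  have h2 : Injective (mfderiv (𝓡 1) (𝓡 3) K (circlePt t)) :=
    Manifold.IsImmersionAtOfComplement.mfderiv_injective (hF (circlePt t)) (by simp)
  have h3 := mfderiv_coe_sphere_injective (E := 𝔼 4) (n := 3) (K (circlePt t))
  have hc : MDifferentiableAt 𝓘(ℝ, ℝ) (𝓡 1) circlePt t :=
    contMDiff_circlePt.contMDiffAt.mdifferentiableAt (by simp)
  have hK : MDifferentiableAt (𝓡 1) (𝓡 3) K (circlePt t) :=
    K.contMDiff.contMDiffAt.mdifferentiableAt (by simp)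
  have hcoe : MDifferentiableAt (𝓡 3) 𝓘(ℝ, 𝔼 4) (Subtype.val : 𝕊 3 → 𝔼 4) (K (circlePt t)) :=
    (contMDiff_coe_sphere (m := 1)).contMDiffAt.mdifferentiableAt one_ne_zero
  have hchain : mfderiv 𝓘(ℝ, ℝ) 𝓘(ℝ, 𝔼 4) K.curve t =
      (mfderiv (𝓡 3) 𝓘(ℝ, 𝔼 4) (Subtype.val : 𝕊 3 → 𝔼 4) (K (circlePt t))).comp
        ((mfderiv (𝓡 1) (𝓡 3) K (circlePt t)).comp (mfderiv 𝓘(ℝ, ℝ) (𝓡 1) circlePt t)) := by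
    rw [show K.curve = Subtype.val ∘ (⇑K ∘ circlePt) from rfl, mfderiv_comp t hcoe (hK.comp t hc),
      mfderiv_comp t hK hc]
    rfl
  have hinj : Injective (mfderiv 𝓘(ℝ, ℝ) 𝓘(ℝ, 𝔼 4) K.curve t) := by
    rw [hchain]
    exact h3.comp (h2.comp h1)
  have hinj' : Injective (fderiv ℝ K.curve t) := by
    have := hinj
    rwa [mfderiv_eq_fderiv] at this
  intro h0
  change fderiv ℝ K.curve t 1 = 0 at h0
  exact one_ne_zero (hinj' (h0.trans (map_zero _).symm))

/-- The velocity of a knot is tangent to the sphere: `⟪K.curve t, (K.curve)' t⟫ = 0`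
(differentiate `‖K.curve t‖² = 1`). [folklore] -/
theorem Knot.inner_curve_deriv_curve (t : ℝ) : ⟪K.curve t, deriv K.curve t⟫ = 0 := by
  have hd : HasDerivAt K.curve (deriv K.curve t) t :=
    (K.contDiff_curve.differentiable (by simp)).differentiableAt.hasDerivAt
  have h := hd.inner ℝ hd
  have hconst : (fun s => ⟪K.curve s, K.curve s⟫) = fun _ => (1 : ℝ) := by
    funext s
    rw [real_inner_self_eq_norm_sq, K.norm_curve, one_pow]
  rw [hconst] at h
  have := h.unique (hasDerivAt_const t (1 : ℝ))
  rw [real_inner_comm (deriv K.curve t)] at this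
  rw [real_inner_comm]
  linarith

/-- The curve of a knot identifies parameters exactly modulo `ℤ`: `K.curve s = K.curve t` iff
`s - t ∈ ℤ` (`K` is injective and `circlePt` identifies exactly modulo `ℤ`). [folklore] -/
theorem Knot.curve_eq_curve_iff {s t : ℝ} : K.curve s = K.curve t ↔ ∃ m : ℤ, s = t + m := by
  rw [Knot.curve_apply, Knot.curve_apply, Subtype.coe_inj, K.injective.eq_iff,
    circlePt_eq_circlePt_iff]

end KnotCurve



/-! ### The quaternion frame -/

section QuatFrame

/-- Right multiplication by the quaternion `i` on `ℝ⁴ = ℍ`: `p ↦ p·i`. [folklore] -/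
def quatI (p : 𝔼 4) : 𝔼 4 := WithLp.toLp 2 ![-p 1, p 0, p 3, -p 2]

/-- Right multiplication by the quaternion `j` on `ℝ⁴ = ℍ`: `p ↦ p·j`. [folklore] -/
def quatJ (p : 𝔼 4) : 𝔼 4 := WithLp.toLp 2 ![-p 2, -p 3, p 0, p 1]

/-- Right multiplication by the quaternion `k` on `ℝ⁴ = ℍ`: `p ↦ p·k`. [folklore] -/
def quatK (p : 𝔼 4) : 𝔼 4 := WithLp.toLp 2 ![-p 3, p 2, -p 1, p 0]

/-- The **quaternion frame** `(p·i, p·j, p·k)` at `p ∈ ℝ⁴`: for `‖p‖ = 1` an orthonormal basis of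
the tangent space `T_p S³ = p^⊥` (the classical parallelisation of `S³`). [folklore] -/
def quatFrame (p : 𝔼 4) (m : Fin 3) : 𝔼 4 := ![quatI p, quatJ p, quatK p] m

/-- The first frame vector is `p·i`. [folklore] -/
@[simp] theorem quatFrame_zero (p : 𝔼 4) : quatFrame p 0 = quatI p := rfl
/-- The second frame vector is `p·j`. [folklore] -/
@[simp] theorem quatFrame_one (p : 𝔼 4) : quatFrame p 1 = quatJ p := rfl
/-- The third frame vector is `p·k`. [folklore] -/
@[simp] theorem quatFrame_two (p : 𝔼 4) : quatFrame p 2 = quatK p := rfl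

/-- Coordinate `0` of `p·i` is `-p 1`. [folklore] -/
@[simp] theorem quatI_apply_zero (p : 𝔼 4) : quatI p 0 = -p 1 := rfl
/-- Coordinate `1` of `p·i` is `p 0`. [folklore] -/
@[simp] theorem quatI_apply_one (p : 𝔼 4) : quatI p 1 = p 0 := rfl
/-- Coordinate `2` of `p·i` is `p 3`. [folklore] -/
@[simp] theorem quatI_apply_two (p : 𝔼 4) : quatI p 2 = p 3 := rfl
/-- Coordinate `3` of `p·i` is `-p 2`. [folklore] -/
@[simp] theorem quatI_apply_three (p : 𝔼 4) : quatI p 3 = -p 2 := rfl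
/-- Coordinate `0` of `p·j` is `-p 2`. [folklore] -/
@[simp] theorem quatJ_apply_zero (p : 𝔼 4) : quatJ p 0 = -p 2 := rfl
/-- Coordinate `1` of `p·j` is `-p 3`. [folklore] -/
@[simp] theorem quatJ_apply_one (p : 𝔼 4) : quatJ p 1 = -p 3 := rfl
/-- Coordinate `2` of `p·j` is `p 0`. [folklore] -/
@[simp] theorem quatJ_apply_two (p : 𝔼 4) : quatJ p 2 = p 0 := rfl
/-- Coordinate `3` of `p·j` is `p 1`. [folklore] -/
@[simp] theorem quatJ_apply_three (p : 𝔼 4) : quatJ p 3 = p 1 := rfl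
/-- Coordinate `0` of `p·k` is `-p 3`. [folklore] -/
@[simp] theorem quatK_apply_zero (p : 𝔼 4) : quatK p 0 = -p 3 := rfl
/-- Coordinate `1` of `p·k` is `p 2`. [folklore] -/
@[simp] theorem quatK_apply_one (p : 𝔼 4) : quatK p 1 = p 2 := rfl
/-- Coordinate `2` of `p·k` is `-p 1`. [folklore] -/
@[simp] theorem quatK_apply_two (p : 𝔼 4) : quatK p 2 = -p 1 := rfl
/-- Coordinate `3` of `p·k` is `p 0`. [folklore] -/
@[simp] theorem quatK_apply_three (p : 𝔼 4) : quatK p 3 = p 0 := rfl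

/-- Inner products on `ℝ⁴` in coordinates. [folklore] -/
theorem inner_fin_four (x y : 𝔼 4) : ⟪x, y⟫ = x 0 * y 0 + x 1 * y 1 + x 2 * y 2 + x 3 * y 3 := by
  rw [real_inner_comm, PiLp.inner_apply, Fin.sum_univ_four]
  simp only [RCLike.inner_apply, conj_trivial]

/-- `p·i ⊥ p`. [folklore] -/
@[simp] theorem inner_quatI_self (p : 𝔼 4) : ⟪quatI p, p⟫ = 0 := by
  rw [inner_fin_four]; simp; ring

/-- `p·j ⊥ p`. [folklore] -/
@[simp] theorem inner_quatJ_self (p : 𝔼 4) : ⟪quatJ p, p⟫ = 0 := by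
  rw [inner_fin_four]; simp; ring

/-- `p·k ⊥ p`. [folklore] -/
@[simp] theorem inner_quatK_self (p : 𝔼 4) : ⟪quatK p, p⟫ = 0 := by
  rw [inner_fin_four]; simp; ring

/-- `p·i ⊥ p·j`. [folklore] -/
@[simp] theorem inner_quatI_quatJ (p : 𝔼 4) : ⟪quatI p, quatJ p⟫ = 0 := by
  rw [inner_fin_four]; simp; ring
/-- `p·i ⊥ p·k`. [folklore] -/
@[simp] theorem inner_quatI_quatK (p : 𝔼 4) : ⟪quatI p, quatK p⟫ = 0 := by
  rw [inner_fin_four]; simp; ring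
/-- `p·j ⊥ p·k`. [folklore] -/
@[simp] theorem inner_quatJ_quatK (p : 𝔼 4) : ⟪quatJ p, quatK p⟫ = 0 := by
  rw [inner_fin_four]; simp; ring
/-- `p·j ⊥ p·i`. [folklore] -/
@[simp] theorem inner_quatJ_quatI (p : 𝔼 4) : ⟪quatJ p, quatI p⟫ = 0 := by
  rw [real_inner_comm]; exact inner_quatI_quatJ p
/-- `p·k ⊥ p·i`. [folklore] -/
@[simp] theorem inner_quatK_quatI (p : 𝔼 4) : ⟪quatK p, quatI p⟫ = 0 := by
  rw [real_inner_comm]; exact inner_quatI_quatK p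
/-- `p·k ⊥ p·j`. [folklore] -/
@[simp] theorem inner_quatK_quatJ (p : 𝔼 4) : ⟪quatK p, quatJ p⟫ = 0 := by
  rw [real_inner_comm]; exact inner_quatJ_quatK p

/-- `⟪p·i, p·i⟫ = ‖p‖²`. [folklore] -/
@[simp] theorem inner_quatI_quatI (p : 𝔼 4) : ⟪quatI p, quatI p⟫ = ‖p‖ ^ 2 := by
  rw [← real_inner_self_eq_norm_sq, inner_fin_four, inner_fin_four]; simp; ring
/-- `⟪p·j, p·j⟫ = ‖p‖²`. [folklore] -/
@[simp] theorem inner_quatJ_quatJ (p : 𝔼 4) : ⟪quatJ p, quatJ p⟫ = ‖p‖ ^ 2 := by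
  rw [← real_inner_self_eq_norm_sq, inner_fin_four, inner_fin_four]; simp; ring
/-- `⟪p·k, p·k⟫ = ‖p‖²`. [folklore] -/
@[simp] theorem inner_quatK_quatK (p : 𝔼 4) : ⟪quatK p, quatK p⟫ = ‖p‖ ^ 2 := by
  rw [← real_inner_self_eq_norm_sq, inner_fin_four, inner_fin_four]; simp; ring

/-- `‖p·i‖ = ‖p‖`. [folklore] -/
@[simp] theorem norm_quatI (p : 𝔼 4) : ‖quatI p‖ = ‖p‖ := by
  rw [EuclideanSpace.norm_eq, EuclideanSpace.norm_eq, Fin.sum_univ_four, Fin.sum_univ_four]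
  congr 1; simp; ring

/-- `‖p·j‖ = ‖p‖`. [folklore] -/
@[simp] theorem norm_quatJ (p : 𝔼 4) : ‖quatJ p‖ = ‖p‖ := by
  rw [EuclideanSpace.norm_eq, EuclideanSpace.norm_eq, Fin.sum_univ_four, Fin.sum_univ_four]
  congr 1; simp; ring

/-- `‖p·k‖ = ‖p‖`. [folklore] -/
@[simp] theorem norm_quatK (p : 𝔼 4) : ‖quatK p‖ = ‖p‖ := by
  rw [EuclideanSpace.norm_eq, EuclideanSpace.norm_eq, Fin.sum_univ_four, Fin.sum_univ_four]
  congr 1; simp; ring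

/-- **Completeness of the frame `(p, p·i, p·j, p·k)`**:
`⟪x, p⟫ p + ⟪x, p·i⟫ p·i + ⟪x, p·j⟫ p·j + ⟪x, p·k⟫ p·k = ‖p‖² x`. [folklore] -/
theorem quatFrame_complete (p x : 𝔼 4) :
    ⟪x, p⟫ • p + ∑ m, ⟪x, quatFrame p m⟫ • quatFrame p m = (‖p‖ ^ 2) • x := by
  rw [← real_inner_self_eq_norm_sq, Fin.sum_univ_three]
  simp only [quatFrame_zero, quatFrame_one, quatFrame_two, inner_fin_four]
  ext i
  fin_cases i <;> simp <;> ring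

end QuatFrame

/-! ### Lifting coefficient vectors into `p^⊥` -/

section FrameLift

/-- The tangent vector `∑ v_m · (quaternion frame)_m` at `p` with coefficient vector
`v : Fin 3 → ℝ`. [folklore] -/
def frameLift (p : 𝔼 4) (v : Fin 3 → ℝ) : 𝔼 4 := ∑ m, v m • quatFrame p m

/-- The coefficient vector `(⟪x, p·i⟫, ⟪x, p·j⟫, ⟪x, p·k⟫)` of `x` in the quaternion frame at `p`.
[folklore] -/
def frameCoord (p x : 𝔼 4) : Fin 3 → ℝ := fun m => ⟪x, quatFrame p m⟫

/-- The lift in terms of `p·i`, `p·j`, `p·k`. [folklore] -/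
theorem frameLift_eq (p : 𝔼 4) (v : Fin 3 → ℝ) :
    frameLift p v = v 0 • quatI p + v 1 • quatJ p + v 2 • quatK p := by
  simp [frameLift, Fin.sum_univ_three]

/-- Lifted vectors are tangent to the sphere at `p`. [folklore] -/
@[simp] theorem inner_frameLift_self (p : 𝔼 4) (v : Fin 3 → ℝ) : ⟪frameLift p v, p⟫ = 0 := by
  simp [frameLift_eq, inner_add_left, inner_smul_left]

/-- The lift is an isometry up to the factor `‖p‖²`. [folklore] -/
theorem inner_frameLift_frameLift (p : 𝔼 4) (v w : Fin 3 → ℝ) :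
    ⟪frameLift p v, frameLift p w⟫ = ‖p‖ ^ 2 * (v ⬝ᵥ w) := by
  simp [frameLift_eq, inner_add_left, inner_add_right, inner_smul_left, inner_smul_right,
    Matrix.vec3_dotProduct]
  ring

/-- Inner products against a lifted vector are dot products of coefficient vectors. [folklore] -/
theorem inner_frameLift_left (p : 𝔼 4) (v : Fin 3 → ℝ) (x : 𝔼 4) :
    ⟪frameLift p v, x⟫ = v ⬝ᵥ frameCoord p x := by
  simp [frameLift_eq, frameCoord, inner_add_right, inner_smul_right, Matrix.vec3_dotProduct,
    real_inner_comm x]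

/-- **Completeness**: a vector orthogonal to the unit vector `p` is the lift of its coefficient
vector. [folklore] -/
theorem frameLift_frameCoord {p x : 𝔼 4} (hp : ‖p‖ = 1) (hx : ⟪x, p⟫ = 0) :
    frameLift p (frameCoord p x) = x := by
  have := quatFrame_complete p x
  rw [hx, zero_smul, zero_add, hp, one_pow, one_smul] at this
  exact this

/-- The coefficient vector of a nonzero tangent vector is nonzero. [folklore] -/
theorem frameCoord_dotProduct_self {p x : 𝔼 4} (hp : ‖p‖ = 1) (hx : ⟪x, p⟫ = 0) :
    frameCoord p x ⬝ᵥ frameCoord p x = ‖x‖ ^ 2 := by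
  have := inner_frameLift_frameLift p (frameCoord p x) (frameCoord p x)
  rw [frameLift_frameCoord hp hx, hp, one_pow, one_mul, real_inner_self_eq_norm_sq] at this
  exact this.symm

end FrameLift

/-! ### A `C¹` family of lines does not fill space -/

section Sard

open MeasureTheory

/-- **A one-parameter differentiable family of lines in `ℝ³` through the origin does not cover
`ℝ³`**: the union `⋃ₜ ℝ · a(t)` is the image of the plane `{x₂ = 0} ⊆ ℝ³` under the
differentiable map `x ↦ x₁ · a(x₀)`, hence Lebesgue-null (the easy case of Sard's theorem,
`MeasureTheory.addHaar_image_eq_zero_of_differentiableOn_of_addHaar_eq_zero`). [folklore] -/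
theorem exists_forall_smul_ne {a : ℝ → (Fin 3 → ℝ)} (ha : Differentiable ℝ a) :
    ∃ p : Fin 3 → ℝ, ∀ (t r : ℝ), r • a t ≠ p := by
  let f : (Fin 3 → ℝ) → (Fin 3 → ℝ) := fun x => x 1 • a (x 0)
  let V : Submodule ℝ (Fin 3 → ℝ) := LinearMap.ker (LinearMap.proj 2)
  have hV : V ≠ ⊤ := by
    intro h
    have : (Pi.single 2 1 : Fin 3 → ℝ) ∈ V := h ▸ Submodule.mem_top
    simp [V] at this
  have hV0 : volume (V : Set (Fin 3 → ℝ)) = 0 := Measure.addHaar_submodule volume V hV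
  have hf : DifferentiableOn ℝ f V := by
    refine Differentiable.differentiableOn ?_
    show Differentiable ℝ fun x : Fin 3 → ℝ => x 1 • a (x 0)
    fun_prop
  have himg : volume (f '' V) = 0 :=
    addHaar_image_eq_zero_of_differentiableOn_of_addHaar_eq_zero volume hf hV0
  by_contra hcon
  push Not at hcon
  have hsub : (univ : Set (Fin 3 → ℝ)) ⊆ f '' V := by
    intro p _
    obtain ⟨t, r, hp⟩ := hcon p
    refine ⟨![t, r, 0], ?_, ?_⟩
    · simp [V]
    · simpa [f] using hp
  have hle := measure_mono (μ := volume) hsub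
  rw [himg, nonpos_iff_eq_zero] at hle
  exact isOpen_univ.measure_ne_zero volume univ_nonempty hle

end Sard

/-! ### Normal framings of regular closed curves on the unit sphere of `ℝ⁴` -/

section Framing

/-- `quatI` is smooth (it is linear). [folklore] -/
theorem contDiff_quatI : ContDiff ℝ ∞ quatI := by
  rw [contDiff_euclidean]
  intro i
  fin_cases i
  · simpa using (contDiff_euclidean.1 contDiff_id 1).neg
  · simpa using (contDiff_euclidean.1 contDiff_id 0)
  · simpa using (contDiff_euclidean.1 contDiff_id 3)
  · simpa using (contDiff_euclidean.1 contDiff_id 2).neg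

/-- `quatJ` is smooth (it is linear). [folklore] -/
theorem contDiff_quatJ : ContDiff ℝ ∞ quatJ := by
  rw [contDiff_euclidean]
  intro i
  fin_cases i
  · simpa using (contDiff_euclidean.1 contDiff_id 2).neg
  · simpa using (contDiff_euclidean.1 contDiff_id 3).neg
  · simpa using (contDiff_euclidean.1 contDiff_id 0)
  · simpa using (contDiff_euclidean.1 contDiff_id 1)

/-- `quatK` is smooth (it is linear). [folklore] -/
theorem contDiff_quatK : ContDiff ℝ ∞ quatK := by
  rw [contDiff_euclidean]
  intro i
  fin_cases i
  · simpa using (contDiff_euclidean.1 contDiff_id 3).neg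
  · simpa using (contDiff_euclidean.1 contDiff_id 2)
  · simpa using (contDiff_euclidean.1 contDiff_id 1).neg
  · simpa using (contDiff_euclidean.1 contDiff_id 0)

/-- The quaternion frame vectors depend smoothly on the point. [folklore] -/
theorem contDiff_quatFrame (m : Fin 3) : ContDiff ℝ ∞ fun p => quatFrame p m := by
  fin_cases m
  · exact contDiff_quatI
  · exact contDiff_quatJ
  · exact contDiff_quatK

variable {k : ℝ → 𝔼 4}

/-- Lifting a smooth coefficient field along a smooth curve gives a smooth vector field.
[folklore] -/
theorem ContDiff.frameLift (hk : ContDiff ℝ ∞ k) {v : ℝ → (Fin 3 → ℝ)} (hv : ContDiff ℝ ∞ v) :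
    ContDiff ℝ ∞ fun t => frameLift (k t) (v t) := by
  unfold Literature.Topology.FourManifolds.frameLift
  refine ContDiff.sum fun m _ => ?_
  exact ((contDiff_apply ℝ ℝ m).comp hv).smul ((contDiff_quatFrame m).comp hk)

/-- The coefficient vector of a smooth vector field along a smooth curve is smooth. [folklore] -/
theorem ContDiff.frameCoord (hk : ContDiff ℝ ∞ k) {x : ℝ → 𝔼 4} (hx : ContDiff ℝ ∞ x) :
    ContDiff ℝ ∞ fun t => frameCoord (k t) (x t) := by
  rw [contDiff_pi]
  intro m
  exact hx.inner ℝ ((contDiff_quatFrame m).comp hk)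

/-- The derivative of a `c`-periodic function on `ℝ` is `c`-periodic (kept `Literature`-local, as
`Literature.Topology.FourManifolds.Function.Periodic.deriv`; Mathlib has `deriv_comp_add_const` but not this packaging).
[folklore] -/
theorem Function.Periodic.deriv {F : Type*} [NormedAddCommGroup F] [NormedSpace ℝ F] {f : ℝ → F}
    {c : ℝ} (h : Periodic f c) : Periodic (_root_.deriv f) c := by
  intro t
  have : (fun s => f (s + c)) = f := funext h
  rw [← deriv_comp_add_const, this]

/-- **Normal framings exist.** A `C^∞` regular closed curve `k : ℝ → S³ ⊆ ℝ⁴` of period `1`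
(`‖k‖ = 1`, `k' ≠ 0`) admits two `C^∞` `1`-periodic normal fields `n₁`, `n₂` such that
`k(t), k'(t), n₁(t), n₂(t)` are pairwise orthogonal and nonzero for every `t`: trivialise
`T S³` by the quaternion frame, so that the unit tangent becomes a smooth loop `a : ℝ → ℝ³ ∖ 0`;
choose an axis `p ∈ ℝ³` off the null set `⋃ₜ ℝ·a(t)` (`exists_forall_smul_ne`); then
`b = ‖a‖² p - ⟪p, a⟫ a` and `c = a × b` are nowhere-vanishing smooth fields orthogonal to `a`,
and `n₁`, `n₂` are their lifts. (The normal bundle of a knot in `S³` is trivial.) [folklore] -/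
theorem exists_normal_framing (hk : ContDiff ℝ ∞ k) (hper : Periodic k 1) (hnorm : ∀ t, ‖k t‖ = 1)
    (hreg : ∀ t, deriv k t ≠ 0) :
    ∃ n₁ n₂ : ℝ → 𝔼 4, ContDiff ℝ ∞ n₁ ∧ ContDiff ℝ ∞ n₂ ∧ Periodic n₁ 1 ∧ Periodic n₂ 1 ∧
      ∀ t, ⟪n₁ t, k t⟫ = 0 ∧ ⟪n₂ t, k t⟫ = 0 ∧ ⟪n₁ t, deriv k t⟫ = 0 ∧ ⟪n₂ t, deriv k t⟫ = 0 ∧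
        ⟪n₁ t, n₂ t⟫ = 0 ∧ n₁ t ≠ 0 ∧ n₂ t ≠ 0 := by
  -- the velocity is smooth, periodic and tangent
  have hk' : ContDiff ℝ ∞ (deriv k) := (contDiff_infty_iff_deriv.1 hk).2
  have hper' : Periodic (deriv k) 1 := Function.Periodic.deriv hper
  have htan : ∀ t, ⟪deriv k t, k t⟫ = 0 := by
    intro t
    have hd : HasDerivAt k (deriv k t) t :=
      (hk.differentiable (by simp)).differentiableAt.hasDerivAt
    have h := hd.inner ℝ hd
    have hconst : (fun s => ⟪k s, k s⟫) = fun _ => (1 : ℝ) := by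
      funext s
      rw [real_inner_self_eq_norm_sq, hnorm, one_pow]
    rw [hconst] at h
    have := h.unique (hasDerivAt_const t (1 : ℝ))
    rw [real_inner_comm (k t)] at this
    rw [real_inner_comm]
    linarith
  -- the tangent indicatrix `a` in the quaternion trivialisation
  set a : ℝ → (Fin 3 → ℝ) := fun t => frameCoord (k t) (deriv k t) with ha_def
  have ha : ContDiff ℝ ∞ a := ContDiff.frameCoord hk hk'
  have haper : Periodic a 1 := fun t => by simp only [ha_def, hper t, hper' t]
  have haa : ∀ t, a t ⬝ᵥ a t = ‖deriv k t‖ ^ 2 := fun t =>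
    frameCoord_dotProduct_self (hnorm t) (htan t)
  have ha0 : ∀ t, a t ⬝ᵥ a t ≠ 0 := fun t => by
    rw [haa]; exact pow_ne_zero 2 (norm_ne_zero_iff.2 (hreg t))
  -- an axis off all the lines `ℝ · a t`
  obtain ⟨p, hp⟩ := exists_forall_smul_ne (ha.differentiable (by simp))
  -- the two coefficient fields
  set b : ℝ → (Fin 3 → ℝ) := fun t => (a t ⬝ᵥ a t) • p - (p ⬝ᵥ a t) • a t with hb_def
  set c : ℝ → (Fin 3 → ℝ) := fun t => a t ⨯₃ b t with hc_def
  have hdotc : ∀ {u v : ℝ → (Fin 3 → ℝ)}, ContDiff ℝ ∞ u → ContDiff ℝ ∞ v →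
      ContDiff ℝ ∞ fun t => u t ⬝ᵥ v t := by
    intro u v hu hv
    simp only [dotProduct]
    exact ContDiff.sum fun i _ =>
      ((contDiff_apply ℝ ℝ i).comp hu).mul ((contDiff_apply ℝ ℝ i).comp hv)
  have hb : ContDiff ℝ ∞ b :=
    ((hdotc ha ha).smul contDiff_const).sub ((hdotc contDiff_const ha).smul ha)
  have hc : ContDiff ℝ ∞ c := by
    rw [contDiff_pi]
    intro i
    fin_cases i <;>
      simp only [hc_def, cross_apply] <;>
      first
      | exact (((contDiff_apply ℝ ℝ _).comp ha).mul ((contDiff_apply ℝ ℝ _).comp hb)).sub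
          (((contDiff_apply ℝ ℝ _).comp ha).mul ((contDiff_apply ℝ ℝ _).comp hb))
  have hbper : Periodic b 1 := fun t => by simp only [hb_def, haper t]
  have hcper : Periodic c 1 := fun t => by simp only [hc_def, haper t, hbper t]
  have hba : ∀ t, b t ⬝ᵥ a t = 0 := fun t => by
    simp only [hb_def, sub_dotProduct, smul_dotProduct, smul_eq_mul, dotProduct_comm p (a t)]
    ring
  have hb0 : ∀ t, b t ≠ 0 := by
    intro t hbt
    have : (a t ⬝ᵥ a t) • p = (p ⬝ᵥ a t) • a t := sub_eq_zero.1 hbt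
    refine hp t ((p ⬝ᵥ a t) / (a t ⬝ᵥ a t)) ?_
    rw [div_eq_inv_mul, mul_smul, ← this, smul_smul, inv_mul_cancel₀ (ha0 t), one_smul]
  have hbb : ∀ t, b t ⬝ᵥ b t ≠ 0 := fun t h => hb0 t (dotProduct_self_eq_zero.1 h)
  have hca : ∀ t, c t ⬝ᵥ a t = 0 := fun t => by
    rw [hc_def, dotProduct_comm]; exact dot_self_cross (a t) (b t)
  have hcb : ∀ t, c t ⬝ᵥ b t = 0 := fun t => by
    rw [hc_def, dotProduct_comm]; exact dot_cross_self (a t) (b t)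
  have hcc : ∀ t, c t ⬝ᵥ c t ≠ 0 := fun t => by
    simp only [hc_def]
    rw [cross_dot_cross, dotProduct_comm (a t) (b t), hba t, mul_zero, sub_zero]
    exact mul_ne_zero (ha0 t) (hbb t)
  -- the normal fields
  refine ⟨fun t => frameLift (k t) (b t), fun t => frameLift (k t) (c t), ContDiff.frameLift hk hb,
    ContDiff.frameLift hk hc, fun t => by simp only [hper t, hbper t], fun t => by
      simp only [hper t, hcper t], fun t => ⟨inner_frameLift_self _ _, inner_frameLift_self _ _,
      ?_, ?_, ?_, ?_, ?_⟩⟩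
  · rw [inner_frameLift_left]; exact hba t
  · rw [inner_frameLift_left]; exact hca t
  · rw [inner_frameLift_frameLift, dotProduct_comm, hcb, mul_zero]
  · intro (h : frameLift (k t) (b t) = 0)
    have := inner_frameLift_frameLift (k t) (b t) (b t)
    rw [h, inner_zero_left, hnorm, one_pow, one_mul] at this
    exact hbb t this.symm
  · intro (h : frameLift (k t) (c t) = 0)
    have := inner_frameLift_frameLift (k t) (c t) (c t)
    rw [h, inner_zero_left, hnorm, one_pow, one_mul] at this
    exact hcc t this.symm

end Framing

end Literature.Topology.FourManifolds
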